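import Summits.BirchSwinnertonDyer.BirchSwinnertonDyer.Theorems.EisensteinPrimesMazurMCOnX1RankZeroInterludeResidualGL1Continuity
import Summits.BirchSwinnertonDyer.BirchSwinnertonDyer.Theorems.EisensteinPrimesMazurMCOnX1RankZeroInterludeResidualGL1Tame
import Summits.BirchSwinnertonDyer.BirchSwinnertonDyer.Theorems.EisensteinPrimesMazurMCOnX1RankZeroInterludeRoadBGL1Reduction
import Summits.BirchSwinnertonDyer.BirchSwinnertonDyer.Theorems.AlignedTransportAtTwoMainConjectureOfRankZeroBSDAtTwoFineRoadInfRes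
import Literature.NumberTheory.IwasawaTheory.ClassicalMuVanishesUnramifiedClasses
import Literature.NumberTheory.EllipticCurves.ZpExtensionRestrictCyclotomic
import Literature.NumberTheory.EllipticCurves.GreenbergVatsal2000.UnramifiedOutsideFinite
import Literature.NumberTheory.EllipticCurves.HeegnerPoints
import Literature.NumberTheory.ComplexMultiplication.TateHalfTransferInducedType
import Literature.NumberTheory.GaloisRepresentations.ArtinRestriction
import Literature.NumberTheory.GaloisRepresentations.AbsIntegersEquiv
import Literature.NumberTheory.GaloisRepresentations.GaloisSubgroups
import Literature.NumberTheory.GaloisRepresentations.DecompositionGroupOfCompletion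
import Literature.NumberTheory.Automorphic.LanglandsTetrahedral
import Summits.BirchSwinnertonDyer.BirchSwinnertonDyer.Theorems.EisensteinPrimesTwoVariableInertiaInput
import HarnessLib

/-!
# Route `EisensteinPrimes`, crux 5 `MazurMCOnX1RankZero` (stmt-BirchSwinnertonDyer-19035), line `interlude_with_torsion`,
# node (B3) `ResidualGL1FinitenessOdd`: the input **[Unr]** of `residualGL1FinitenessOdd_of_unr_even'`
# (`Theorems/…InterludeResidualGL1Tame`) REDUCED TO THE TWO PRINTED THEOREMS of classical Iwasawa theory —
# Ferrero–Washington (`ferreroWashington1979_classicalMuVanishes`) and "`μ = 0` ⇒ finitely many everywhere-unramified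
# classes" (`classicalMuVanishes_finite_unramifiedClasses`) — for a GENERAL residual character (not only the trivial one).

Ideator workfile (bsd-idea-11 g17, lens `nearmiss`; publish-only, W-71/W-79).  BSD is not proved here; no statement of the
summit is proved by this file.  What is proved (sorry-free):

* §1 `PrimeOrder`: on a module `M` of prime order every group element acts by an integer scalar.
* §2 `Transport` (generic, for a finite extension `F/K` of number fields of degree prime to `p` inside which `Γ_F` acts on `M`
  through `res : Γ_F → Γ_K`): the pull-back `resField : H¹(K_∞, M) → H¹(F_∞, M)` along `res : Gal(F̄/F_∞) → Gal(K̄/K_∞)`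
  (`F_∞ = F·K_∞`, `κ_F = κ ∘ res`), with
  - `resField_mem_unramifiedKer`: an everywhere-unramified class (Greenberg–Vatsal kernels `unramifiedKer`, all places, all
    conjugates) pulls back to an everywhere-unramified class — inertia groups of `F` restrict into inertia groups of `K`
    (`absGaloisRestrict_mem_inertia_comap`), and a GV-unramified class dies on EVERY inertia group above `v`
    (`resOfLe_inertia_inf_eq_zero_of_forall`, the Greenberg–Vatsal transitivity argument);
  - `finite_preimage_resField`: when `res(Γ_F) ⊴ Γ_K` and `Γ_K` acts continuously, `resField` has finite fibres — its kernel
    restricts to zero on the finite-index subgroup `ker κ ∩ res(Γ_F)` of `ker κ`, so it is caught by the finite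
    inflation–restriction kernel `finite_ker_resOfLe` (`Theorems/AlignedTransport…FineRoadInfRes`).
* §3 `Cutout`: for `K/ℚ` quadratic and `M` of order `p` with a `Γ_ℚ`-action inducing the (continuous) `Γ_K`-action, the field
  `F = ℚ̄^{N}`, `N = res_{K/ℚ}(ker(Γ_K → Aut M))`, is an ABELIAN number field containing (a copy of) `K`, of degree `[F:K] =
  #(Γ_K · m₀) < p` over `K`, with `res(Γ_F) = ker(Γ_K → Aut M)` (`exists_trivialising_abelian_field`).  Ingredients: `res(Γ_K)`
  has index `2` in `Γ_ℚ` (so it is normal with abelian quotient — `Subgroup.mul_mem_iff_of_index_two`), `Γ_ℚ` acts on `M` by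
  commuting scalars (§1), the infinite Galois correspondence for open subgroups (`ArtinRestriction`), and the tower mediator
  `towerGaloisRep` (`conj_absGaloisRestrict_absGaloisRestrict`).
* §4 `Assembly`: **`unrInput_of_ferreroWashington`** `: ferreroWashington1979_classicalMuVanishes →
  classicalMuVanishes_finite_unramifiedClasses → [Unr]` with `[Unr]` token-for-token the hypothesis `hUnr` of
  `InterludeWithTorsion.residualGL1FinitenessOdd_of_unr_even'`.  Proof: WLOG `Γ_K` acts continuously (else `H¹(K_∞, M) = 0`,
  `discreteH1_eq_zero_of_not_continuous` + `continuous_smul_of_continuous_smul_kerSubgroup`, W2's `…ResidualGL1Continuity`);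
  take `F` from §3; `κ_F = κ.restrict F` is cyclotomic (`isCyclotomic_restrict`) and `Γ_F` acts trivially on `M`, so
  Ferrero–Washington for the abelian field `F` and `classicalMuVanishes_finite_unramifiedClasses` give finiteness of the
  everywhere-unramified classes in `H¹(F_∞, M)`; §2 transports it down to `K_∞`.  Corollaries BY NAME:
  **`gl1InputUnramified_of_ferreroWashington`** `: FW → U → RoadBHelpers.GL1InputUnramified` (= the TYPE of the registered v10
  stub `stub_gl1InputUnramified`, `Theorems/…InterludeRoadBGL1Reduction`; so that stub is closed MODULO the two named facts, i.e.
  it joins the PUB list) and **`residualGL1FinitenessOdd_of_ferreroWashington_even`** `: FW → U → [Even] →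
  InterludeWithTorsion.ResidualGL1FinitenessOdd` ((B3) BY NAME from PUB ∧ [Even]).

LEDGER (numbers, not adjectives): farm `lean check` rc 0 · errors 0 · warnings 0 · sorries 0; 20 declarations; conditional
inputs = exactly the two `def … : Prop` named facts of `Literature/NumberTheory/IwasawaTheory` (Ferrero–Washington 1979;
Washington §13.5 Prop. 13.28), displayed as hypotheses; no new axioms, no `@[conjecture]` introduced.  Road B's (B3) thereby rests
on PUB ∧ [Even] (Greenberg LNM 1716 Lemma 5.9 over `K_∞`, W2's `hEven`); crux 5 BY NAME on PUB ∧ crux 2 ∧ XI″ ∧ [Even].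

References: B. Ferrero, L. Washington, Ann. of Math. 109 (1979) 377–395 [FerreroWashington1979]; L. Washington,
*Introduction to Cyclotomic Fields*, §13.5 (Prop. 13.28: `μ = 0` and unramified classes) [Washington1997];
R. Greenberg, V. Vatsal, Invent. Math. 142 (2000), §2 [GreenbergVatsal2000]; J.-P. Serre, *Galois Cohomology*, I §2.6, I §5
[SerreGaloisCohomology1997]; J. Neukirch, *Algebraic Number Theory*, Ch. I §9, Ch. II §9, Ch. IV §1 [NeukirchANT1999].
-/

noncomputable section

set_option linter.dupNamespace false
set_option autoImplicit false

open scoped NumberField Pointwise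
open Field IsDedekindDomain
open Literature.NumberTheory.GaloisRepresentations
open Literature.NumberTheory.EllipticCurves Literature.NumberTheory.EllipticCurves.GreenbergSelmer
open Literature.NumberTheory.EllipticCurves.GreenbergVatsal2000

universe u

namespace Summit.BirchSwinnertonDyer.BirchSwinnertonDyer.Theorems.InterludeWithTorsion.UnrTransport


/-! ## §1 Modules of prime order: group elements act by integer scalars -/

section PrimeOrder

variable {Γ : Type u} [Group Γ] {M : Type u} [AddCommGroup M] [DistribMulAction Γ M]

/-- A group of prime order is generated (over `ℤ`) by a non-zero element. [folklore] -/
theorem exists_forall_exists_zsmul_eq {p : ℕ} [Fact p.Prime] (hcard : Nat.card M = p) :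
    ∃ m₀ : M, m₀ ≠ 0 ∧ ∀ m : M, ∃ n : ℤ, n • m₀ = m := by
  haveI := isAddCyclic_of_prime_card hcard
  obtain ⟨g, hg⟩ := IsAddCyclic.exists_zsmul_surjective (G := M)
  refine ⟨g, ?_, fun m ↦ hg m⟩
  rintro rfl
  haveI : Subsingleton M := ⟨fun a b ↦ by
    obtain ⟨i, rfl⟩ := hg a
    obtain ⟨j, rfl⟩ := hg b
    simp⟩
  have h1 : Nat.card M = 1 := Nat.card_of_subsingleton (0 : M)
  rw [hcard] at h1
  exact (Fact.out : p.Prime).one_lt.ne' h1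

/-- On a module of prime order every group element acts by an integer scalar (the action is additive and `M` is
cyclic). [folklore] -/
theorem exists_int_forall_smul_eq {p : ℕ} [Fact p.Prime] (hcard : Nat.card M = p) (g : Γ) :
    ∃ k : ℤ, ∀ m : M, g • m = k • m := by
  obtain ⟨m₀, -, hgen⟩ := exists_forall_exists_zsmul_eq (M := M) hcard
  obtain ⟨k, hk⟩ := hgen (g • m₀)
  refine ⟨k, fun m ↦ ?_⟩
  obtain ⟨n, rfl⟩ := hgen m
  rw [smul_comm g n m₀, ← hk, smul_smul, smul_smul, mul_comm]

/-- An element fixing a generator fixes everything. [folklore] -/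
theorem smul_eq_self_of_smul_generator_eq {g : Γ} {m₀ : M} (hgen : ∀ m : M, ∃ n : ℤ, n • m₀ = m)
    (hg : g • m₀ = m₀) (m : M) : g • m = m := by
  obtain ⟨n, rfl⟩ := hgen m
  rw [smul_comm g n m₀, hg]

/-- Membership in the kernel of the action. [folklore] -/
theorem mem_ker_toPermHom_iff (g : Γ) :
    g ∈ (MulAction.toPermHom Γ M).ker ↔ ∀ m : M, g • m = m := by
  rw [MonoidHom.mem_ker, Equiv.ext_iff]
  rfl

end PrimeOrder

/-! ## §2 Transport of everywhere-unramified classes along a finite extension `F/K` -/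

section OverK

variable {K : Type} [Field K] [NumberField K]
variable (H : Subgroup (absoluteGaloisGroup K)) [H.Normal]
variable (M : Type) [AddCommGroup M] [DistribMulAction (absoluteGaloisGroup K) M] [TopologicalSpace M]
  [DiscreteTopology M]

variable {H M} in
/-- **A class all of whose conjugates lie in every `unramifiedKer H M v` dies on EVERY inertia group `I_𝔓 ∩ H`, `𝔓 ∣ v`**
(not only on the chosen `I_{𝔓₀}`): the Greenberg–Vatsal transitivity argument of
`GreenbergVatsal2000.resOfLe_inertia_inf_eq_zero_of_mem_unramifiedOutside`, with the set of excluded places empty.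
[cite: GreenbergVatsal2000, §2 pp. 16–17] [cite: NeukirchANT1999, Ch. I §9 Prop. (9.1)] -/
theorem resOfLe_inertia_inf_eq_zero_of_forall {c : subgroupH1 H M}
    (hc : ∀ (v : HeightOneSpectrum (𝓞 K)) (σ : absoluteGaloisGroup K), conjH1 H M σ c ∈ unramifiedKer H M v)
    {v : HeightOneSpectrum (𝓞 K)} {𝔓 : Ideal (absIntegers (𝓞 K) K)} (h𝔓 : 𝔓 ∈ v.primesAbove) :
    resOfLe M (inf_le_right : 𝔓.inertia (absoluteGaloisGroup K) ⊓ H ≤ H) c = 0 := by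
  classical
  obtain ⟨z, rfl⟩ := oneCocycleClass_surjective _ c
  -- `𝔓 = ρ₀ • 𝔓₀`
  obtain ⟨ρ₀, hρ₀⟩ := HeightOneSpectrum.exists_smul_eq_of_mem_primesAbove_holds
    (adicCompletionPrime_mem_primesAbove K v) h𝔓
  -- the GV condition for the conjugate `ρ₀⁻¹`
  have h1 := hc v ρ₀⁻¹
  rw [conjH1_oneCocycleClass_mem_unramifiedKer_iff] at h1
  obtain ⟨a, ha⟩ := h1
  rw [CocycleCriteria.resOfLe_oneCocycleClass_eq_zero_iff]
  refine ⟨ρ₀ • a, fun x => ?_⟩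
  have hxI : (x : absoluteGaloisGroup K) ∈ 𝔓.inertia (absoluteGaloisGroup K) := x.2.1
  have hxH : (x : absoluteGaloisGroup K) ∈ H := x.2.2
  -- `y = ρ₀⁻¹ x ρ₀ ∈ H ∩ I_{𝔓₀}`
  have hyI : ρ₀⁻¹ * (x : absoluteGaloisGroup K) * ρ₀ ∈ GreenbergSelmer.inertia v := by
    rw [GreenbergSelmer.inertia, ← inertia_adicCompletionPrime_eq_map_absInertia]
    refine (Ideal.conj_mem_inertia_smul_iff (adicCompletionPrime K v) ρ₀ _).mp ?_
    rw [hρ₀, show ρ₀ * (ρ₀⁻¹ * (x : absoluteGaloisGroup K) * ρ₀) * ρ₀⁻¹ = (x : absoluteGaloisGroup K) by group]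
    exact hxI
  have hyD : ρ₀⁻¹ * (x : absoluteGaloisGroup K) * ρ₀ ∈ GreenbergSelmer.decomp v :=
    GreenbergSelmer.inertia_le_decomp v hyI
  have hyH : ρ₀⁻¹ * (x : absoluteGaloisGroup K) * ρ₀ ∈ H := Subgroup.Normal.conj_mem' inferInstance _ hxH ρ₀
  let y : inertiaIn H v := ⟨⟨ρ₀⁻¹ * (x : absoluteGaloisGroup K) * ρ₀, hyD⟩, (mem_inertiaIn_iff H v _).2 ⟨hyH, hyI⟩⟩
  have key := ha y
  have e : subgroupConj H ρ₀⁻¹ (inertiaInToH H v y) = Subgroup.inclusion inf_le_right x := by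
    apply Subtype.ext
    rw [subgroupConj_apply_coe]
    change ρ₀⁻¹⁻¹ * (ρ₀⁻¹ * (x : absoluteGaloisGroup K) * ρ₀) * ρ₀⁻¹ = (x : absoluteGaloisGroup K)
    group
  rw [e] at key
  change ρ₀⁻¹ • z.1 (Subgroup.inclusion inf_le_right x) = (ρ₀⁻¹ * (x : absoluteGaloisGroup K) * ρ₀) • a - a at key
  have key' := congrArg (fun m : M => ρ₀ • m) key
  dsimp only at key'
  rw [smul_inv_smul, smul_sub, ← mul_smul,
    show ρ₀ * (ρ₀⁻¹ * (x : absoluteGaloisGroup K) * ρ₀) = (x : absoluteGaloisGroup K) * ρ₀ by group, mul_smul] at key'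
  exact key'

end OverK

section Transport

variable {K F : Type} [Field K] [Field F] [NumberField F] [Algebra K F]
variable {p : ℕ} [Fact p.Prime] (κ : ZpExtension K p)
  (hs : Function.Surjective (κ.toContinuousMonoidHom.comp (absGaloisRestrict K F)))
variable (M : Type) [AddCommGroup M] [DistribMulAction (absoluteGaloisGroup K) M]
  [DistribMulAction (absoluteGaloisGroup F) M] [TopologicalSpace M] [DiscreteTopology M]

/-- `res` maps `ker κ_F` into `ker κ` (`κ_F = κ ∘ res`). [cite: Washington1997, §13.1] -/
theorem absGaloisRestrict_mem_kerSubgroup {σ : absoluteGaloisGroup F} (hσ : σ ∈ (κ.restrict F hs).kerSubgroup) :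
    absGaloisRestrict K F σ ∈ κ.kerSubgroup := by
  rw [ZpExtension.kerSubgroup_restrict] at hσ
  exact hσ

/-- Conversely, `res σ ∈ ker κ` implies `σ ∈ ker κ_F`. [cite: Washington1997, §13.1] -/
theorem mem_kerSubgroup_restrict_of {σ : absoluteGaloisGroup F} (hσ : absGaloisRestrict K F σ ∈ κ.kerSubgroup) :
    σ ∈ (κ.restrict F hs).kerSubgroup := by
  rw [ZpExtension.kerSubgroup_restrict]
  exact hσ

/-- `res : Gal(F̄/F_∞) → Gal(K̄/K_∞)`, the restriction `Γ_F → Γ_K` on the kernels of `κ_F = κ ∘ res` and `κ`.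
[cite: Washington1997, §13.1] [cite: SerreGaloisCohomology1997, I §2.4] -/
def kerRestrict : (κ.restrict F hs).kerSubgroup →ₜ* κ.kerSubgroup where
  toFun x := ⟨absGaloisRestrict K F x, absGaloisRestrict_mem_kerSubgroup κ hs x.2⟩
  map_one' := Subtype.ext (map_one (absGaloisRestrict K F))
  map_mul' x y := Subtype.ext (map_mul (absGaloisRestrict K F) (x : absoluteGaloisGroup F) (y : absoluteGaloisGroup F))
  continuous_toFun :=
    ((absGaloisRestrict K F).continuous.comp continuous_subtype_val).subtype_mk _

/-- Unfolding `kerRestrict` on the underlying elements of `Γ_K`. [folklore] -/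
@[simp]
theorem kerRestrict_apply_coe (x : (κ.restrict F hs).kerSubgroup) :
    ((kerRestrict κ hs x : κ.kerSubgroup) : absoluteGaloisGroup K) = absGaloisRestrict K F x := rfl

variable (hMF : ∀ (σ : absoluteGaloisGroup F) (m : M), σ • m = (absGaloisRestrict K F σ) • m)
include hMF

/-- **The pull-back `H¹(K_∞, M) → H¹(F_∞, M)`** along `res : Gal(F̄/F_∞) → Gal(K̄/K_∞)` (`F_∞ = F K_∞`), for a
`Γ_K`-module `M` on which `Γ_F` acts through `res`. [cite: SerreGaloisCohomology1997, I §2.4 (compatible pairs)] -/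
def resField : subgroupH1 κ.kerSubgroup M →+ subgroupH1 (κ.restrict F hs).kerSubgroup M :=
  resH1Hom (kerRestrict κ hs) (AddMonoidHom.id M) (fun x m ↦ by
    rw [AddMonoidHom.id_apply, AddMonoidHom.id_apply, Subgroup.smul_def, Subgroup.smul_def, kerRestrict_apply_coe, hMF])

/-- `resField` on an explicit class: the class of the pulled-back cocycle `x ↦ z (res x)`.
[cite: SerreGaloisCohomology1997, I §2.4] -/
theorem resField_oneCocycleClass (z : contOneCocycles (discreteTopRep κ.kerSubgroup M)) :
    resField κ hs M hMF (oneCocycleClass _ z) =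
      oneCocycleClass (discreteTopRep (κ.restrict F hs).kerSubgroup M)
        (contOneCocycles.pullback (kerRestrict κ hs) (resHomOfEquivariant (kerRestrict κ hs) (AddMonoidHom.id M)
          (fun x m ↦ by
            rw [AddMonoidHom.id_apply, AddMonoidHom.id_apply, Subgroup.smul_def, Subgroup.smul_def,
              kerRestrict_apply_coe, hMF])) z) :=
  resH1Hom_oneCocycleClass _ _ _ z

variable [NumberField K]

/-- **Everywhere-unramified classes pull back to everywhere-unramified classes.**  For `w` a place of `F` over `v`,
`σ' ∈ Γ_F` and `y ∈ I_w ∩ ker κ_F`: `res(σ'⁻¹ y σ') ∈ I_𝔓 ∩ ker κ` for the prime `𝔓 = res(σ')⁻¹ • (𝔓₀(w) ∩ K̄)` above `v`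
(`absGaloisRestrict_mem_inertia_comap`), where the class dies by `resOfLe_inertia_inf_eq_zero_of_forall`.
[cite: GreenbergVatsal2000, §2 pp. 16–17] [cite: NeukirchANT1999, Ch. I §9, Ch. II §9 Prop. (9.6)] -/
theorem resField_mem_unramifiedKer (c : subgroupH1 κ.kerSubgroup M)
    (hc : ∀ (v : HeightOneSpectrum (𝓞 K)) (σ : absoluteGaloisGroup K),
      conjH1 κ.kerSubgroup M σ c ∈ unramifiedKer κ.kerSubgroup M v)
    (w : HeightOneSpectrum (𝓞 F)) (σ' : absoluteGaloisGroup F) :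
    conjH1 (κ.restrict F hs).kerSubgroup M σ' (resField κ hs M hMF c) ∈
      unramifiedKer (κ.restrict F hs).kerSubgroup M w := by
  classical
  obtain ⟨z, rfl⟩ := oneCocycleClass_surjective _ c
  set H := κ.kerSubgroup with hHdef
  set H' := (κ.restrict F hs).kerSubgroup with hH'def
  set r := absGaloisRestrict K F with hrdef
  -- the place below `w`, the distinguished prime of `F̄` at `w`, its contraction to `K̄`, and its conjugate
  set v : HeightOneSpectrum (𝓞 K) := w.under (𝓞 K) with hvdef
  have hvw : w.asIdeal.under (𝓞 K) = v.asIdeal := rfl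
  set 𝔔₀ := adicCompletionPrime F w with h𝔔₀
  have h𝔓₁ : 𝔔₀.comap (absIntegersMap K F) ∈ v.primesAbove :=
    comap_absIntegersMap_mem_primesAbove hvw (adicCompletionPrime_mem_primesAbove F w)
  set ρ : absoluteGaloisGroup K := r σ' with hρdef
  have h𝔓 : ρ⁻¹ • 𝔔₀.comap (absIntegersMap K F) ∈ v.primesAbove := smul_mem_primesAbove h𝔓₁ ρ⁻¹
  -- the class dies on `I_𝔓 ∩ H`
  have hdies := resOfLe_inertia_inf_eq_zero_of_forall (H := H) (M := M) hc h𝔓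
  rw [CocycleCriteria.resOfLe_oneCocycleClass_eq_zero_iff] at hdies
  obtain ⟨a, ha⟩ := hdies
  -- unfold the pulled-back, conjugated class
  rw [resField_oneCocycleClass, conjH1_oneCocycleClass_mem_unramifiedKer_iff]
  refine ⟨σ' • a, fun y ↦ ?_⟩
  have hy := (mem_inertiaIn_iff H' w _).1 y.2
  have hyH' : ((y : decomp (K := F) w) : absoluteGaloisGroup F) ∈ H' := hy.1
  have hyI : ((y : decomp (K := F) w) : absoluteGaloisGroup F) ∈ 𝔔₀.inertia (absoluteGaloisGroup F) := by
    rw [h𝔔₀, ← Summit.BirchSwinnertonDyer.BirchSwinnertonDyer.Theorems.IwasawaTwoVariable.greenbergSelmer_inertia_eq]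
    exact hy.2
  -- `x₀ = ρ⁻¹ · res(y) · ρ ∈ I_𝔓 ∩ H`
  have hry_I : r y ∈ (𝔔₀.comap (absIntegersMap K F)).inertia (absoluteGaloisGroup K) :=
    absGaloisRestrict_mem_inertia_comap K F hyI
  have hry_H : r y ∈ H := absGaloisRestrict_mem_kerSubgroup κ hs hyH'
  have hx₀I : ρ⁻¹ * r y * ρ ∈ (ρ⁻¹ • 𝔔₀.comap (absIntegersMap K F)).inertia (absoluteGaloisGroup K) := by
    have := (Ideal.conj_mem_inertia_smul_iff (𝔔₀.comap (absIntegersMap K F)) ρ⁻¹ (r y)).mpr hry_I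
    simpa only [inv_inv] using this
  have hx₀H : ρ⁻¹ * r y * ρ ∈ H := Subgroup.Normal.conj_mem' inferInstance _ hry_H ρ
  have key := ha ⟨ρ⁻¹ * r y * ρ, hx₀I, hx₀H⟩
  -- the argument of the pulled-back cocycle is `x₀`
  have e : kerRestrict κ hs (subgroupConj H' σ' (inertiaInToH H' w y)) =
      Subgroup.inclusion inf_le_right ⟨ρ⁻¹ * r y * ρ, hx₀I, hx₀H⟩ := by
    apply Subtype.ext
    rw [kerRestrict_apply_coe, subgroupConj_apply_coe]
    change r (σ'⁻¹ * ((y : decomp (K := F) w) : absoluteGaloisGroup F) * σ') = ρ⁻¹ * r y * ρ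
    rw [map_mul, map_mul, map_inv]
  rw [pullback_resHomOfEquivariant_apply, AddMonoidHom.id_apply, e, key, hMF σ', smul_sub, ← mul_smul,
    show ρ * (ρ⁻¹ * r y * ρ) = r y * ρ by group, mul_smul, hMF, hMF σ' a]

/-- **The pull-back has finite fibres** when `res(Γ_F)` is normal in `Γ_K` and `Γ_K` acts continuously on the finite
module `M`: a class in its kernel restricts to zero on `ker κ ∩ res(Γ_F)`, a subgroup of finite index of `ker κ`
normalised by it, and the kernel of that restriction is finite by inflation–restriction (`finite_ker_resOfLe`).
[cite: SerreGaloisCohomology1997, I §2.6 (b)] -/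
theorem finite_preimage_resField [Finite M]
    (hnorm : ((absGaloisRestrict K F).range : Subgroup (absoluteGaloisGroup K)).Normal)
    (hcont : ∀ m : M, Continuous fun g : absoluteGaloisGroup K ↦ g • m)
    {T : Set (subgroupH1 (κ.restrict F hs).kerSubgroup M)} (hT : T.Finite) :
    {c : subgroupH1 κ.kerSubgroup M | resField κ hs M hMF c ∈ T}.Finite := by
  classical
  set H := κ.kerSubgroup with hHdef
  set R : Subgroup (absoluteGaloisGroup K) := (absGaloisRestrict K F).range with hRdef
  have hle : H ⊓ R ≤ H := inf_le_left
  -- (1) the kernel of `resField` restricts to zero on `H ⊓ R`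
  have hker : ∀ c, resField κ hs M hMF c = 0 → resOfLe M hle c = 0 := by
    intro c hc
    obtain ⟨z, rfl⟩ := oneCocycleClass_surjective _ c
    obtain ⟨n, hn⟩ := (CocycleCriteria.resH1Hom_oneCocycleClass_eq_zero_iff _ _ _ z).mp hc
    rw [CocycleCriteria.resOfLe_oneCocycleClass_eq_zero_iff]
    refine ⟨n, fun x ↦ ?_⟩
    obtain ⟨y, hy⟩ : (x : absoluteGaloisGroup K) ∈ R := x.2.2
    have hy' : absGaloisRestrict K F y = (x : absoluteGaloisGroup K) := hy
    have hyH : y ∈ (κ.restrict F hs).kerSubgroup :=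
      mem_kerSubgroup_restrict_of κ hs (by rw [hy']; exact x.2.1)
    have key := hn ⟨y, hyH⟩
    have e : kerRestrict κ hs ⟨y, hyH⟩ = Subgroup.inclusion hle x := Subtype.ext hy'
    rw [e, AddMonoidHom.id_apply, Subgroup.smul_def, hMF] at key
    rw [key]
    change (absGaloisRestrict K F y) • n - n = _
    rw [hy']
  -- (2) that restriction kernel is finite (inflation–restriction)
  have hRidx : R.index = Module.finrank K F := index_range_absGaloisRestrict_eq_finrank K F
  haveI : FiniteDimensional K F := Module.Finite.of_restrictScalars_finite ℚ K F
  have hRne : R.index ≠ 0 := by rw [hRidx]; exact Module.finrank_pos.ne'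
  have hind : ((H ⊓ R).subgroupOf H).FiniteIndex := by
    refine ⟨fun h0 ↦ hRne ?_⟩
    have h1 : (H ⊓ R).relIndex H = 0 := h0
    rw [Subgroup.inf_relIndex_left] at h1
    exact Subgroup.index_eq_zero_of_relIndex_eq_zero h1
  have hK₀ : {c : subgroupH1 H M | resOfLe M hle c = 0}.Finite :=
    AlignedTransportAtTwoFineRoad.InfRes.finite_ker_resOfLe hle
      (fun g hg h hh ↦ ⟨H.mul_mem (H.mul_mem (H.inv_mem hg) hh.1) hg, hnorm.conj_mem' _ hh.2 g⟩)
      hind hcont inferInstance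
  -- (3) fibres are translates of the kernel
  change ((resField κ hs M hMF) ⁻¹' T).Finite
  refine hT.preimage' fun b _ ↦ ?_
  by_cases hb : ∃ c₀, resField κ hs M hMF c₀ = b
  · obtain ⟨c₀, hc₀⟩ := hb
    refine (hK₀.image fun k ↦ c₀ + k).subset fun c hc ↦ ?_
    refine ⟨c - c₀, hker _ ?_, by abel⟩
    rw [map_sub, hc₀, show resField κ hs M hMF c = b from hc, sub_self]
  · have : (resField κ hs M hMF) ⁻¹' {b} = ∅ :=
      Set.eq_empty_iff_forall_notMem.mpr fun c hc ↦ hb ⟨c, hc⟩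
    rw [this]
    exact Set.finite_empty

end Transport

end Summit.BirchSwinnertonDyer.BirchSwinnertonDyer.Theorems.InterludeWithTorsion.UnrTransport
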